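import Summits.MatrixMultiplication.OmegaCensus.STPPZoo313CounterSound
import Summits.MatrixMultiplication.OmegaCensus.STPPVosperSlackTwoCheckersSound2

/-!
# ω-census (abelian STPP census): soundness pieces for the zoo checker — the COUNTING IDENTITY behind the failure counters (kernel tool)

HONEST FRAMING (pub-omega census; verbatim): lottery ticket; floor = certified bounds/negative ranges.
Census STRUCTURE (seat pub-omega-stpp-1 gen 33, 2026-08-29), family (b2).  Third soundness piece for `zooLeaf` (`STPPZoo313Checker.lean`):
for `Y ⊆ ℤ/p` with value list `vs` (no element of value `p − 1`), `U₁ = maskOf vs ∨ (maskOf vs ≪ 1)` is the value mask of `Y ∪ (Y + 1)` (`tb_U1_iff`), the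
success mask `((U₁ ∨ (U₁ ≪ p)) ≫ b) ∧ fullMask` of an element of value `b` has bit `y.val` iff `b + y ∈ Y ∪ (Y+1)` (`tb_succMask`), and
`#({0, 1, y} + Y) = #(Y ∪ (Y+1)) + #{e ∈ Y : e + y ∉ Y ∪ (Y+1)}` (`card_triple_add`) `= popc U₁ + failCount … y.val` (`card_triple_add_masks`).  So "two above"
(`= |Y| + 4`) means: `popc U₁ = |Y| + r` and exactly `4 − r` failures.  Remaining for the zoo theorem: the difference-sequence normal form of `Y` and
`popc U₁ = |Y| + 1 + #{big differences}` (HOME `pub-omega-stpp-1-g33/lean/spec/ZooSoundSpec.lean`).  No `decide`.  Nothing here is progress on `ω`.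

References: H. Cohn, R. Kleinberg, B. Szegedy, C. Umans, FOCS 2005 (arXiv:math/0511460), Def. 5.1.
-/

open Finset
open scoped Pointwise

namespace Summit.MatrixMultiplication.OmegaCensus.CubeNB.S2

open Summit.MatrixMultiplication.OmegaCensus.CubeNB.Bits

/-! ## §1 Bits of shifted masks -/

/-- Bit `v` of `m ≪ 1`. [folklore] -/
theorem tb_shiftLeft_one (m v : ℕ) : tb (m <<< 1) v = (decide (1 ≤ v) && tb m (v - 1)) := by
  rw [tb_eq_testBit, tb_eq_testBit, Nat.testBit_shiftLeft]

/-- Bit `v` of `m ≫ i`. [folklore] -/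
theorem tb_shiftRight (m i v : ℕ) : tb (m >>> i) v = tb m (i + v) := by
  rw [tb_eq_testBit, tb_eq_testBit, Nat.testBit_shiftRight]

/-- Bit `v` of `m ≪ i`. [folklore] -/
theorem tb_shiftLeft (m i v : ℕ) : tb (m <<< i) v = (decide (i ≤ v) && tb m (v - i)) := by
  rw [tb_eq_testBit, tb_eq_testBit, Nat.testBit_shiftLeft]

variable {p : ℕ} [hp : Fact p.Prime]

/-! ## §2 The mask `U₁` of `Y ∪ (Y + 1)` and the success masks -/

/-- **`U₁` is the value mask of `Y ∪ (Y+1)`** (no element of `Y` has value `p − 1`). [folklore] -/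
theorem tb_U1_iff {Y : Finset (ZMod p)} {vs : List ℕ} (hvs : ∀ v, v ∈ vs ↔ ∃ e ∈ Y, e.val = v) (hmax : ∀ v ∈ vs, v + 1 < p) (v : ℕ) :
    tb (maskOf vs ||| (maskOf vs <<< 1)) v = true ↔ ∃ e ∈ Y ∪ Y.image (· + 1), e.val = v := by
  rw [tb_lor, Bool.or_eq_true, tb_maskOf, tb_shiftLeft_one, Bool.and_eq_true, decide_eq_true_eq, tb_maskOf, hvs]
  constructor
  · rintro (⟨e, he, rfl⟩ | ⟨h1, hv⟩)
    · exact ⟨e, mem_union_left _ he, rfl⟩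
    · obtain ⟨e, he, hev⟩ := (hvs _).1 hv
      have hlt := hmax _ hv
      refine ⟨e + 1, mem_union_right _ (mem_image.2 ⟨e, he, rfl⟩), ?_⟩
      rw [ZMod.val_add, ZMod.val_one, hev, Nat.mod_eq_of_lt (by omega)]; omega
  · rintro ⟨e, he, rfl⟩
    rcases mem_union.1 he with he | he
    · exact Or.inl ⟨e, he, rfl⟩
    · obtain ⟨e', he', rfl⟩ := mem_image.1 he
      right
      have hv' : e'.val ∈ vs := (hvs _).2 ⟨e', he', rfl⟩
      have hlt := hmax _ hv'
      have hval : (e' + 1).val = e'.val + 1 := by rw [ZMod.val_add, ZMod.val_one, Nat.mod_eq_of_lt (by omega)]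
      rw [hval]
      exact ⟨by omega, by rw [Nat.add_sub_cancel]; exact hv'⟩

omit hp in
/-- **The success mask of an element of value `b`**: bit `yv < p` of `((U₁ ∨ (U₁ ≪ p)) ≫ b) ∧ fullMask p` is bit `(b + yv) mod p` of `U₁`
(`U₁ < 2^p`, `b < p`). [folklore] -/
theorem tb_succMask {U1 : ℕ} (hU1 : U1 < 2 ^ p) {b yv : ℕ} (hb : b < p) (hyv : yv < p) :
    tb (((U1 ||| (U1 <<< p)) >>> b) &&& fullMask p) yv = tb U1 ((b + yv) % p) := by
  rw [tb_land, tb_fullMask, decide_eq_true hyv, Bool.and_true, tb_shiftRight, tb_lor, tb_shiftLeft]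
  by_cases hlt : b + yv < p
  · rw [Nat.mod_eq_of_lt hlt, decide_eq_false (by omega), Bool.false_and, Bool.or_false]
  · rw [not_lt] at hlt
    have h1 : tb U1 (b + yv) = false := tb_eq_false_of_lt hU1 hlt
    have hmod : (b + yv) % p = b + yv - p := by
      rw [Nat.mod_eq_sub_mod hlt, Nat.mod_eq_of_lt (by omega)]
    rw [h1, Bool.false_or, decide_eq_true hlt, Bool.true_and, hmod]

omit hp in
/-- The success masks are below `2^p`. [folklore] -/
theorem succMask_lt (U1 b : ℕ) : ((U1 ||| (U1 <<< p)) >>> b) &&& fullMask p < 2 ^ p := by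
  rw [fullMask_eq]
  exact lt_of_le_of_lt Nat.and_le_right (by have := Nat.one_le_two_pow (n := p); omega)

/-! ## §3 The counting identity -/

/-- `{0, 1, y} + Y = (Y ∪ (Y+1)) ∪ (Y + y)`. [folklore] -/
theorem triple_add_eq (Y : Finset (ZMod p)) (y : ZMod p) :
    ({0, 1, y} : Finset (ZMod p)) + Y = (Y ∪ Y.image (· + 1)) ∪ Y.image (· + y) := by
  ext w
  rw [Finset.mem_add]
  simp only [mem_insert, mem_singleton, mem_union, mem_image]
  constructor
  · rintro ⟨x, hx, e, he, rfl⟩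
    rcases hx with rfl | rfl | rfl
    · left; left; rwa [zero_add]
    · left; right; exact ⟨e, he, by ring⟩
    · right; exact ⟨e, he, by ring⟩
  · rintro ((hw | ⟨e, he, rfl⟩) | ⟨e, he, rfl⟩)
    · exact ⟨0, Or.inl rfl, w, hw, zero_add w⟩
    · exact ⟨1, Or.inr (Or.inl rfl), e, he, by ring⟩
    · exact ⟨y, Or.inr (Or.inr rfl), e, he, by ring⟩

/-- **The counting identity**: `#({0,1,y} + Y) = #(Y ∪ (Y+1)) + #{e ∈ Y : e + y ∉ Y ∪ (Y+1)}`. [folklore] -/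
theorem card_triple_add (Y : Finset (ZMod p)) (y : ZMod p) :
    #(({0, 1, y} : Finset (ZMod p)) + Y) = #(Y ∪ Y.image (· + 1)) + #(Y.filter fun e => e + y ∉ Y ∪ Y.image (· + 1)) := by
  rw [triple_add_eq]
  have h := Finset.card_sdiff_add_card (s := Y.image (· + y)) (t := Y ∪ Y.image (· + 1))
  rw [union_comm (Y ∪ Y.image (· + 1)) (Y.image (· + y)), ← h, Finset.sdiff_eq_filter, Finset.filter_image,
    card_image_of_injective _ (add_left_injective y), Nat.add_comm]

/-- **The counting identity in mask terms**: with `vs` the duplicate-free value list of `Y` (no value `p − 1`), `U₁ = maskOf vs ∨ (maskOf vs ≪ 1)`: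
`#({0,1,y} + Y) = popc U₁ + failCount (vs.map successMask) y.val`. [folklore] -/
theorem card_triple_add_masks (Y : Finset (ZMod p)) (y : ZMod p) (vs : List ℕ) (hvs : ∀ v, v ∈ vs ↔ ∃ e ∈ Y, e.val = v) (hnd : vs.Nodup)
    (hmax : ∀ v ∈ vs, v + 1 < p) :
    #(({0, 1, y} : Finset (ZMod p)) + Y) =
      popc (List.range p) (maskOf vs ||| (maskOf vs <<< 1)) +
        failCount (vs.map fun b => (((maskOf vs ||| (maskOf vs <<< 1)) ||| ((maskOf vs ||| (maskOf vs <<< 1)) <<< p)) >>> b) &&& fullMask p)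
          y.val := by
  set U1 := maskOf vs ||| (maskOf vs <<< 1) with hU1def
  have hvlt : ∀ v ∈ vs, v < p := fun v hv => by have := hmax v hv; omega
  have hU1lt : U1 < 2 ^ p := by
    refine Nat.lt_pow_two_of_testBit _ fun i hi => ?_
    rw [← tb_eq_testBit, Bool.eq_false_iff]
    intro htb
    obtain ⟨e, _, hev⟩ := (tb_U1_iff hvs hmax i).1 htb
    have := e.val_lt; omega
  rw [card_triple_add]
  congr 1
  · -- `#(Y ∪ (Y+1)) = popc U₁`
    rw [popc_eq_length_members]
    have hndm : (members (List.range p) U1).Nodup := nodup_members List.nodup_range _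
    have hset : (members (List.range p) U1).toFinset = (Y ∪ Y.image (· + 1)).image ZMod.val := by
      ext v
      rw [List.mem_toFinset, mem_members, List.mem_range, mem_image]
      constructor
      · rintro ⟨_, htb⟩; exact (tb_U1_iff hvs hmax v).1 htb
      · rintro ⟨e, he, rfl⟩; exact ⟨e.val_lt, (tb_U1_iff hvs hmax _).2 ⟨e, he, rfl⟩⟩
    rw [← List.toFinset_card_of_nodup hndm, hset, card_image_of_injective _ (ZMod.val_injective p)]
  · -- the failures
    unfold failCount
    rw [List.filter_map, List.length_map]
    set P : ℕ → Bool := (fun S => !tb S y.val) ∘ fun b => ((U1 ||| (U1 <<< p)) >>> b) &&& fullMask p with hP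
    have hndf : (vs.filter P).Nodup := hnd.filter _
    have hset : (vs.filter P).toFinset = (Y.filter fun e => e + y ∉ Y ∪ Y.image (· + 1)).image ZMod.val := by
      ext v
      rw [List.mem_toFinset, List.mem_filter, mem_image]
      constructor
      · rintro ⟨hv, hPv⟩
        obtain ⟨e, he, rfl⟩ := (hvs v).1 hv
        refine ⟨e, mem_filter.2 ⟨he, fun hin => ?_⟩, rfl⟩
        have hsucc : tb (((U1 ||| (U1 <<< p)) >>> e.val) &&& fullMask p) y.val = true := by
          rw [tb_succMask hU1lt e.val_lt y.val_lt, tb_U1_iff hvs hmax]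
          exact ⟨e + y, hin, by rw [ZMod.val_add]⟩
        have : P e.val = false := by simp only [hP, Function.comp, hsucc]; rfl
        rw [this] at hPv; exact Bool.noConfusion hPv
      · rintro ⟨e, he, rfl⟩
        rw [mem_filter] at he
        refine ⟨(hvs _).2 ⟨e, he.1, rfl⟩, ?_⟩
        have hfail : tb (((U1 ||| (U1 <<< p)) >>> e.val) &&& fullMask p) y.val = false := by
          rw [tb_succMask hU1lt e.val_lt y.val_lt, Bool.eq_false_iff]
          intro htb
          obtain ⟨e', he', hev'⟩ := (tb_U1_iff hvs hmax _).1 htb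
          apply he.2
          have : e' = e + y := by apply ZMod.val_injective p; rw [hev', ZMod.val_add]
          rw [← this]; exact he'
        simp only [hP, Function.comp, hfail]; rfl
    rw [← List.toFinset_card_of_nodup hndf, hset, card_image_of_injective _ (ZMod.val_injective p)]

end Summit.MatrixMultiplication.OmegaCensus.CubeNB.S2
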